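import Literature.InformationTheory.QuantumCodes.LossThresholdPeriodicLift
import Literature.InformationTheory.QuantumCodes.TwistedToricHomology
import Literature.InformationTheory.QuantumCodes.TwistedToricDistance
import Literature.InformationTheory.QuantumCodes.AbelianTwoBlockNoiseSymmetry
import HarnessLib

/-!
# The loss threshold of EVERY twisted / rotated toric code family is EXACTLY `1/2`

Topic `Literature/InformationTheory/QuantumCodes` (venture QEC, LADDER-QEC rung Q5; qec-type-03). All PROVED, no named fact, kernel
axioms. Type-08's twisted toric code `TwistedToric.code g₁ g₂` of a finite abelian group (Kitaev's code on `ℝ²/Λ`,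
`Λ = {m : m₁g₁ + m₂g₂ = 0}`: the `L × L` toric code, Kovalev–Pryadko's rotated codes `[[2t²+2(t+1)², 2, 2t+1]]`, …) is fed to
the one-arm threshold schema for periodic lifts (`isThresholdLowerBound_half_of_lift`, `LossThresholdPeriodicLift.lean`):

* `wedges_subset_supp_of_decomposition` — the closed walks of type-08's `cycle_decomposition` use ONLY links of the cycle;
* `exists_closedWalk_of_not_isCorrectableErasure` — an uncorrectable loss pattern contains a closed walk of lost links whose
  `ℤ²`-displacement is a NON-ZERO period (`systole_le_hammingNorm_of_zLogical`'s argument);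
* `twistedLift v Er` — the periodic lift of the lost links centred at the vertex `v` (bond `{x, x + eᵢ}` open iff the link of
  type `i` at `v + rel x` is lost); it is injective on the links of `B(n)` when `4n + 1 ≤ sys₁(Λ)` and the lifted walk leaves
  that box (`‖μ‖₁ ≥ sys₁`), whence **`exists_twistedLift_mem_siteToBoundary`** — a one-arm event of radius `n = ⌊(sys₁ − 1)/4⌋`;
* **`twistedToric_lossThreshold_half`** — for every family `(G_i; g₁ⁱ, g₂ⁱ)` with `|G_i| · e^{-c ⌊(sys₁(Λ_i) − 1)/4⌋} → 0` for all
  `c > 0`, every loss rate `y < 1/2` is below threshold (Kesten); with the abelian two-block no-cloning ceiling (`k = 2` when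
  `g₁, g₂` generate): **`twistedToric_loss_accuracyThreshold_eq_half`** — the loss threshold is EXACTLY `1/2`.

References: [StaceBarrettDoherty2009] PRL 102 (2009) 200501, p. 1–3 (loss threshold `0.5`); [KovalevPryadko2013Hyperbicycle]
PRA 88 (2013) 012311, §III.B Ex. 2 (rotated toric codes); [KestenCMP1980] Comm. Math. Phys. 74 (1980) 41–59, Thm. 2 (1.7).
-/

open private linkSym2_injective from Literature.InformationTheory.QuantumCodes.ToricCodeErasureHalfLaw
open private exists_pathIn_innerBoundary from Literature.InformationTheory.QuantumCodes.PlanarCodeErasureHalfGeometry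

namespace Literature.InformationTheory.QuantumCodes

namespace TwistedToric

open Finset Matrix Filter Topology
open Literature.Probability.LatticeModels (Site box zdGraph innerBoundary mem_box zero_mem_box zdGraph_adj_iff)
open Literature.Probability.Percolation (BondConfig openGraph openGraph_adj siteToBoundary bondPercolation PathIn)

variable {G : Type*} [AddCommGroup G] [DecidableEq G]

/-! ### The closed walks of a cycle decomposition use only links of the cycle -/

/-- The set of links traversed by the walk `w` from `v`. [cite: DennisEtAl2002, §3.1 (the links of an error chain)] -/
def wedges (g₁ g₂ : G) : G → List Step → Finset (G ⊕ G)
  | _, [] => ∅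
  | v, s :: t => insert (s.edge g₁ g₂ v) (wedges g₁ g₂ (s.move g₁ g₂ v) t)

/-- The chain of a walk is supported on its links. [cite: DennisEtAl2002, §3.1 (links of a chain)] -/
theorem wchain_ne_zero_mem_wedges (g₁ g₂ : G) :
    ∀ (w : List Step) (v : G) (e : G ⊕ G), wchain g₁ g₂ v w e ≠ 0 → e ∈ wedges g₁ g₂ v w := by
  intro w
  induction w with
  | nil => intro v e h; simp at h
  | cons s t ih =>
    intro v e h
    rw [wedges, Finset.mem_insert]
    by_cases he : e = s.edge g₁ g₂ v
    · exact Or.inl he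
    · right
      refine ih _ e ?_
      rw [wchain_cons, Pi.add_apply, Pi.single_apply, if_neg he, zero_add] at h
      exact h

/-- A walk has at most as many links as steps. [cite: DennisEtAl2002, §3.1 (links of a chain)] -/
theorem card_wedges_le (g₁ g₂ : G) : ∀ (w : List Step) (v : G), (wedges g₁ g₂ v w).card ≤ w.length := by
  intro w
  induction w with
  | nil => intro v; simp [wedges]
  | cons s t ih =>
    intro v
    rw [wedges, List.length_cons]
    exact (Finset.card_insert_le _ _).trans (by have := ih (s.move g₁ g₂ v); omega)

/-- The union of the link sets of a list of walks, and its two properties. [cite: DennisEtAl2002, §3.1] -/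
def wedgesUnion (g₁ g₂ : G) : List (G × List Step) → Finset (G ⊕ G)
  | [] => ∅
  | c :: cs => wedges g₁ g₂ c.1 c.2 ∪ wedgesUnion g₁ g₂ cs

/-- A link of some walk of the list lies in the union. [cite: DennisEtAl2002, §3.1] -/
theorem wedges_subset_wedgesUnion (g₁ g₂ : G) : ∀ (cs : List (G × List Step)) (c : G × List Step), c ∈ cs →
    wedges g₁ g₂ c.1 c.2 ⊆ wedgesUnion g₁ g₂ cs := by
  intro cs
  induction cs with
  | nil => intro c hc; simp at hc
  | cons c' cs ih =>
    intro c hc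
    rw [wedgesUnion]
    rcases List.mem_cons.1 hc with rfl | hc
    · exact Finset.subset_union_left
    · exact (ih c hc).trans Finset.subset_union_right

/-- The union has at most `Σ` (steps) links. [cite: DennisEtAl2002, §3.1] -/
theorem card_wedgesUnion_le (g₁ g₂ : G) : ∀ cs : List (G × List Step),
    (wedgesUnion g₁ g₂ cs).card ≤ (cs.map fun c => c.2.length).sum := by
  intro cs
  induction cs with
  | nil => simp [wedgesUnion]
  | cons c cs ih =>
    rw [wedgesUnion, List.map_cons, List.sum_cons]
    exact (Finset.card_union_le _ _).trans (Nat.add_le_add (card_wedges_le g₁ g₂ c.2 c.1) ih)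

/-- The sum of the walk chains is supported on the union of the link sets. [cite: DennisEtAl2002, §3.1] -/
theorem sum_ne_zero_mem_wedgesUnion (g₁ g₂ : G) : ∀ (cs : List (G × List Step)) (e : G ⊕ G),
    (cs.map fun c => wchain g₁ g₂ c.1 c.2).sum e ≠ 0 → e ∈ wedgesUnion g₁ g₂ cs := by
  intro cs
  induction cs with
  | nil => intro e h; simp at h
  | cons c cs ih =>
    intro e h
    rw [wedgesUnion, Finset.mem_union]
    rw [List.map_cons, List.sum_cons, Pi.add_apply] at h
    by_cases h1 : wchain g₁ g₂ c.1 c.2 e = 0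
    · rw [h1, zero_add] at h
      exact Or.inr (ih e h)
    · exact Or.inl (wchain_ne_zero_mem_wedges g₁ g₂ c.2 c.1 e h1)

/-- **The walks of an exact decomposition use only links of the cycle**: if `z = Σ wchain cᵢ` with `Σ |cᵢ| = |z|` then every
link of every `cᵢ` lies in the support of `z`. [cite: DennisEtAl2002, §3.1 (a cycle as an edge-disjoint sum of closed loops)] -/
theorem wedges_subset_supp_of_decomposition [Fintype G] (g₁ g₂ : G) {z : G ⊕ G → ZMod 2} {cs : List (G × List Step)}
    (hsum : z = (cs.map fun c => wchain g₁ g₂ c.1 c.2).sum) (hlen : (cs.map fun c => c.2.length).sum = hammingNorm z)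
    {c : G × List Step} (hc : c ∈ cs) : wedges g₁ g₂ c.1 c.2 ⊆ supp z := by
  classical
  have hsub : supp z ⊆ wedgesUnion g₁ g₂ cs := by
    intro e he
    have hz : z e ≠ 0 := by simpa [supp] using he
    rw [hsum] at hz
    exact sum_ne_zero_mem_wedgesUnion g₁ g₂ cs e hz
  have hcard : (wedgesUnion g₁ g₂ cs).card ≤ (supp z).card := by
    have h1 := card_wedgesUnion_le g₁ g₂ cs
    rw [hlen] at h1
    exact h1
  have heq : supp z = wedgesUnion g₁ g₂ cs := Finset.eq_of_subset_of_card_le hsub hcard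
  rw [heq]
  exact wedges_subset_wedgesUnion g₁ g₂ cs c hc

/-- **An uncorrectable loss pattern contains a closed walk of lost links with non-zero period displacement.**
[cite: StaceBarrettDoherty2009, p. 2 (a homologically nontrivial cycle inside the lost set)] -/
theorem exists_closedWalk_of_not_isCorrectableErasure [Fintype G] (g₁ g₂ : G) {Er : Finset (G ⊕ G)}
    (hEr : ¬ IsCorrectableErasure {z : G ⊕ G → ZMod 2 | (code g₁ g₂).HX *ᵥ z = 0}
      ((code g₁ g₂).rowSpZ : Set (G ⊕ G → ZMod 2)) Er) :
    ∃ (v : G) (w : List Step), wedges g₁ g₂ v w ⊆ Er ∧ IsPeriod g₁ g₂ (ndisp w) ∧ ndisp w ≠ 0 := by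
  classical
  unfold IsCorrectableErasure at hEr
  push Not at hEr
  obtain ⟨z, hz, hzE, hz'⟩ := hEr
  have hstar : ∀ i, star g₁ g₂ z i = 0 := fun i => by
    have := congr_fun hz i; rwa [code_HX_mulVec] at this
  obtain ⟨cs, hcl, hsum, hlen⟩ := cycle_decomposition g₁ g₂ z hstar
  obtain ⟨c, hc, hbad⟩ : ∃ c ∈ cs, ¬ ∃ μ : ℤ × ℤ, IsPeriod g₁ g₂ μ ∧ ndisp c.2 = μ + μ := by
    by_contra hall
    apply hz'
    rw [hsum]
    exact list_sum_mem_rowSpZ g₁ g₂ cs fun c hc => by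
      by_contra hno; exact hall ⟨c, hc, hno⟩
  have hper : IsPeriod g₁ g₂ (ndisp c.2) := (closed_iff_isPeriod g₁ g₂ c.1 c.2).1 (hcl c hc)
  have hne : ndisp c.2 ≠ 0 := by
    intro h0; exact hbad ⟨0, isPeriod_zero g₁ g₂, by rw [h0, add_zero]⟩
  exact ⟨c.1, c.2, (wedges_subset_supp_of_decomposition g₁ g₂ hsum hlen hc).trans hzE, hper, hne⟩

/-! ### The periodic lift centred at a vertex -/

/-- `ℤ × ℤ → ℤ²` (coordinates as a function on `Fin 2`). [folklore] -/
def toSite (m : ℤ × ℤ) : Site 2 := ![m.1, m.2]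
/-- `ℤ² → ℤ × ℤ`. [folklore] -/
def ofSite (x : Site 2) : ℤ × ℤ := (x 0, x 1)
/-- Round trip. [folklore] -/
private theorem ofSite_toSite (m : ℤ × ℤ) : ofSite (toSite m) = m := by
  obtain ⟨a, b⟩ := m; simp [ofSite, toSite]
/-- Round trip. [folklore] -/
private theorem toSite_ofSite (x : Site 2) : toSite (ofSite x) = x := by
  funext j; fin_cases j <;> simp [ofSite, toSite]
/-- Additivity. [folklore] -/
private theorem toSite_add (m m' : ℤ × ℤ) : toSite (m + m') = toSite m + toSite m' := by
  funext j; fin_cases j <;> simp [toSite]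
/-- The first unit vector. [folklore] -/
private theorem toSite_e1 : toSite ((1 : ℤ), (0 : ℤ)) = Pi.single 0 1 := by
  funext j; fin_cases j <;> simp [toSite]
/-- The second unit vector. [folklore] -/
private theorem toSite_e2 : toSite ((0 : ℤ), (1 : ℤ)) = Pi.single 1 1 := by
  funext j; fin_cases j <;> simp [toSite]

/-- **The code link covered by a link of `ℤ²`** (lift centred at `v`): the horizontal bond at `x` covers the link
`v + rel x → v + rel x + g₁` (`inl`), the vertical one the link `→ + g₂` (`inr`). [cite: KovalevPryadko2012, §III.C (the covering lattice)] -/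
def linkAt (g₁ g₂ : G) (v : G) (d : Site 2 × Fin 2) : G ⊕ G :=
  if d.2 = 0 then Sum.inl (v + rel g₁ g₂ (ofSite d.1)) else Sum.inr (v + rel g₁ g₂ (ofSite d.1))

/-- **The periodic lift of a loss pattern centred at `v`**: the bond `{x, x + eᵢ}` of `ℤ²` is open iff the code link it covers
is lost. [cite: StaceBarrettDoherty2009, p. 2 (lost qubits as bonds)] -/
def twistedLift (g₁ g₂ : G) (v : G) (Er : Finset (G ⊕ G)) : BondConfig (Site 2) :=
  {e | ∃ d : Site 2 × Fin 2, e = s(d.1, d.1 + Pi.single d.2 (1 : ℤ)) ∧ linkAt g₁ g₂ v d ∈ Er}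

omit [DecidableEq G] in
/-- The lift consists of bonds of `ℤ²`. [cite: StaceBarrettDoherty2009, p. 2] -/
theorem twistedLift_subset_edgeSet (g₁ g₂ : G) (v : G) (Er : Finset (G ⊕ G)) :
    twistedLift g₁ g₂ v Er ⊆ (zdGraph 2).edgeSet := by
  rintro e ⟨d, rfl, -⟩
  rw [SimpleGraph.mem_edgeSet, zdGraph_adj_iff]
  exact ⟨d.2, Or.inl rfl⟩

omit [DecidableEq G] in
/-- Membership of a bond in the lift. [cite: StaceBarrettDoherty2009, p. 2] -/
theorem mem_twistedLift_iff (g₁ g₂ : G) (v : G) (Er : Finset (G ⊕ G)) (d : Site 2 × Fin 2) :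
    s(d.1, d.1 + Pi.single d.2 (1 : ℤ)) ∈ twistedLift g₁ g₂ v Er ↔ linkAt g₁ g₂ v d ∈ Er := by
  constructor
  · rintro ⟨d', hd', h⟩
    have : d = d' := linkSym2_injective hd'
    rwa [this]
  · exact fun h => ⟨d, rfl, h⟩

omit [DecidableEq G] in
/-- A lost link of the step `s` at the vertex `v + rel q` opens the bond `{q, q + disp s}` of the lift centred at `v`.
[cite: KovalevPryadko2012, §III.C (steps in the covering lattice)] -/
theorem adj_twistedLift_of_mem (g₁ g₂ : G) (v : G) {Er : Finset (G ⊕ G)} (s : Step) (q : ℤ × ℤ)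
    (h : s.edge g₁ g₂ (v + rel g₁ g₂ q) ∈ Er) :
    (openGraph (twistedLift g₁ g₂ v Er)).Adj (toSite q) (toSite (q + s.disp)) := by
  rw [openGraph_adj]
  refine ⟨?_, fun heq => ?_⟩
  · cases s with
    | hp =>
      refine ⟨(toSite q, 0), by rw [toSite_add, Step.disp, toSite_e1], ?_⟩
      simpa [linkAt, ofSite_toSite, Step.edge] using h
    | hm =>
      refine ⟨(toSite (q + Step.hm.disp), 0), ?_, ?_⟩
      · rw [Sym2.eq_swap, ← toSite_e1, ← toSite_add]
        congr 2
        simp [Step.disp, Prod.ext_iff]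
      · have e : rel g₁ g₂ Step.hm.disp = -g₁ := by simp [Step.disp, rel_apply]
        simpa [linkAt, ofSite_toSite, Step.edge, e, sub_eq_add_neg, add_assoc] using h
    | vp =>
      refine ⟨(toSite q, 1), by rw [toSite_add, Step.disp, toSite_e2], ?_⟩
      simpa [linkAt, ofSite_toSite, Step.edge] using h
    | vm =>
      refine ⟨(toSite (q + Step.vm.disp), 1), ?_, ?_⟩
      · rw [Sym2.eq_swap, ← toSite_e2, ← toSite_add]
        congr 2
        simp [Step.disp, Prod.ext_iff]
      · have e : rel g₁ g₂ Step.vm.disp = -g₂ := by simp [Step.disp, rel_apply]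
        simpa [linkAt, ofSite_toSite, Step.edge, e, sub_eq_add_neg, add_assoc] using h
  · have h1 := congrArg ofSite heq
    rw [ofSite_toSite, ofSite_toSite] at h1
    have h2 : s.disp = 0 := by simpa using h1
    have h3 := Step.l1_disp s
    rw [h2] at h3
    simp [l1] at h3

/-- **The lifted walk is open**: a walk of lost links from `v + rel q` lifts to an open path of the lift centred at `v` from
`q` to `q + ndisp w`. [cite: KovalevPryadko2012, §III.C (lifting paths to the covering lattice)] -/
theorem reachable_twistedLift (g₁ g₂ : G) (v : G) {Er : Finset (G ⊕ G)} :
    ∀ (w : List Step) (q : ℤ × ℤ), wedges g₁ g₂ (v + rel g₁ g₂ q) w ⊆ Er →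
      (openGraph (twistedLift g₁ g₂ v Er)).Reachable (toSite q) (toSite (q + ndisp w)) := by
  intro w
  induction w with
  | nil => intro q _; simp [ndisp]
  | cons s t ih =>
    intro q hsub
    rw [wedges] at hsub
    have h1 : s.edge g₁ g₂ (v + rel g₁ g₂ q) ∈ Er := hsub (Finset.mem_insert_self _ _)
    have h2 : wedges g₁ g₂ (v + rel g₁ g₂ (q + s.disp)) t ⊆ Er := by
      have e : s.move g₁ g₂ (v + rel g₁ g₂ q) = v + rel g₁ g₂ (q + s.disp) := by
        rw [Step.move_eq_add_rel, map_add, add_assoc]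
      rw [← e]
      exact (Finset.subset_insert _ _).trans hsub
    have h3 := ih (q + s.disp) h2
    rw [ndisp, ← add_assoc]
    exact (adj_twistedLift_of_mem g₁ g₂ v s q h1).reachable.trans h3

omit [DecidableEq G] in
/-- The systole is positive for a finite group (a horizontal period `(|G|, 0)` exists).
[cite: KovalevPryadko2012, §III.C (the period lattice of a finite torus is nondegenerate)] -/
theorem one_le_systole [Fintype G] (g₁ g₂ : G) : 1 ≤ systole g₁ g₂ := by
  obtain ⟨a, ha, hper⟩ := exists_hPeriod g₁ g₂
  have hne : (((a : ℤ), (0 : ℤ)) : ℤ × ℤ) ≠ 0 := by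
    intro h; have := congrArg Prod.fst h; simp at this; omega
  have hmem : systole g₁ g₂ ∈ {n | ∃ m : ℤ × ℤ, IsPeriod g₁ g₂ m ∧ m ≠ 0 ∧ l1 m = n} :=
    Nat.sInf_mem ⟨_, _, hper, hne, rfl⟩
  obtain ⟨m, -, hm0, hml⟩ := hmem
  rw [← hml]
  by_contra h
  push Not at h
  exact hm0 ((l1_eq_zero_iff m).1 (by omega))

omit [DecidableEq G] in
/-- **Injectivity of the covering on a small box**: if `4n + 1 ≤ sys₁(Λ)`, the links of `B(n)` cover distinct code links.
[cite: KovalevPryadko2012, §III.C (points identified iff they differ by a period)] -/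
theorem injOn_linkAt (g₁ g₂ : G) (v : G) {n : ℕ} (hn : 4 * n + 1 ≤ systole g₁ g₂) :
    Set.InjOn (linkAt g₁ g₂ v) ↑(((box 2 n ×ˢ (univ : Finset (Fin 2))).filter
      (fun d : Site 2 × Fin 2 => d.1 + Pi.single d.2 1 ∈ box 2 n))) := by
  rintro ⟨x, i⟩ hx ⟨x', i'⟩ hx' h
  simp only [Finset.coe_filter, Finset.mem_product, Finset.mem_univ, and_true, Set.mem_setOf_eq] at hx hx'
  have hx1 := (mem_box.1 hx.1)
  have hx2 := (mem_box.1 hx'.1)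
  -- same type of link, same covered vertex
  have hii : i = i' := by
    unfold linkAt at h
    by_contra hne
    fin_cases i <;> fin_cases i' <;> simp_all
  subst hii
  have hv : v + rel g₁ g₂ (ofSite x) = v + rel g₁ g₂ (ofSite x') := by
    unfold linkAt at h
    fin_cases i <;> simpa using h
  have hrel : rel g₁ g₂ (ofSite x - ofSite x') = 0 := by
    rw [map_sub, sub_eq_zero]; exact add_left_cancel hv
  have hper : IsPeriod g₁ g₂ (ofSite x - ofSite x') := (isPeriod_iff_rel _ _ _).2 hrel
  by_cases hd : ofSite x - ofSite x' = 0
  · rw [sub_eq_zero] at hd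
    have : x = x' := by rw [← toSite_ofSite x, hd, toSite_ofSite]
    rw [this]
  · have hs := systole_le hper hd
    have h0 := hx1 0; have h1 := hx1 1; have h0' := hx2 0; have h1' := hx2 1
    simp only [l1, ofSite, Prod.fst_sub, Prod.snd_sub] at hs
    omega

/-- **An uncorrectable loss pattern of a twisted toric code produces a one-arm event** of radius `n` (`4n + 1 ≤ sys₁(Λ)`) in the
lift centred at some vertex. [cite: StaceBarrettDoherty2009, p. 2–3 (a percolated region of losses spanning the torus)] -/
theorem exists_twistedLift_mem_siteToBoundary [Fintype G] (g₁ g₂ : G) {n : ℕ} (hn : 4 * n + 1 ≤ systole g₁ g₂)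
    {Er : Finset (G ⊕ G)} (hEr : ¬ IsCorrectableErasure {z : G ⊕ G → ZMod 2 | (code g₁ g₂).HX *ᵥ z = 0}
      ((code g₁ g₂).rowSpZ : Set (G ⊕ G → ZMod 2)) Er) :
    ∃ v : G, twistedLift g₁ g₂ v Er ∈ siteToBoundary 2 n := by
  classical
  obtain ⟨v, w, hsub, hper, hne⟩ := exists_closedWalk_of_not_isCorrectableErasure g₁ g₂ hEr
  refine ⟨v, ?_⟩
  have hreach := reachable_twistedLift g₁ g₂ v w 0 (by simpa using hsub)
  rw [zero_add] at hreach
  have h0 : toSite (0 : ℤ × ℤ) = 0 := by funext j; fin_cases j <;> simp [toSite]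
  rw [h0] at hreach
  have hout : toSite (ndisp w) ∉ box 2 n := by
    have hs := systole_le hper hne
    intro hb
    have hb' := mem_box.1 hb
    have h0 := hb' 0; have h1 := hb' 1
    simp only [toSite, Matrix.cons_val_zero, Matrix.cons_val_one] at h0 h1
    simp only [l1] at hs
    omega
  obtain ⟨x, hx, hpath⟩ := exists_pathIn_innerBoundary
    (fun p q h => by
      have := twistedLift_subset_edgeSet g₁ g₂ v Er ((openGraph_adj _ _ _).1 h).1
      exact (SimpleGraph.mem_edgeSet (zdGraph 2)).1 this)
    (zero_mem_box 2 n) hout hreach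
  rw [Literature.Probability.Percolation.DCT16.mem_siteToBoundary_iff]
  exact ⟨x, hx, hpath⟩

/-! ### The threshold -/

open Classical in
/-- **Loss threshold `≥ 1/2` for every twisted toric family** whose size is sub-exponential in the systole: if
`|G_i| · e^{-c ⌊(sys₁(Λ_i) − 1)/4⌋} → 0` for every `c > 0`, then every loss rate `0 ≤ y < 1/2` is below threshold for the
`Z`-sector loss-uncorrectability family of the codes `code (g₁ i) (g₂ i)` (Kesten's theorem via the one-arm schema).
[cite: StaceBarrettDoherty2009, p. 2–3 (for p_loss < 0.5 loss recovery almost surely succeeds)] [cite: KestenCMP1980, Thm. 2 (1.7)] -/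
theorem twistedToric_lossThreshold_half {Gs : ℕ → Type*} [∀ i, AddCommGroup (Gs i)] [∀ i, DecidableEq (Gs i)]
    [∀ i, Fintype (Gs i)] (g₁ g₂ : ∀ i, Gs i)
    (hgrowth : ∀ c : ℝ, 0 < c → Tendsto (fun i => (Fintype.card (Gs i) : ℝ) *
      Real.exp (-c * (((systole (g₁ i) (g₂ i) - 1) / 4 : ℕ) : ℝ))) atTop (𝓝 0)) :
    IsThresholdLowerBound (fun i y => ErasureDecoder.uncorrectableProb
      {z : Gs i ⊕ Gs i → ZMod 2 | (code (g₁ i) (g₂ i)).HX *ᵥ z = 0}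
      ((code (g₁ i) (g₂ i)).rowSpZ : Set (Gs i ⊕ Gs i → ZMod 2)) y) (1 / 2) := by
  set r : ℕ → ℕ := fun i => (systole (g₁ i) (g₂ i) - 1) / 4 with hr
  have hrn : ∀ i, 4 * r i + 1 ≤ systole (g₁ i) (g₂ i) := fun i => by
    have := one_le_systole (g₁ i) (g₂ i)
    show 4 * ((systole (g₁ i) (g₂ i) - 1) / 4) + 1 ≤ systole (g₁ i) (g₂ i)
    omega
  have h := isThresholdLowerBound_half_of_lift (V := fun i => Gs i ⊕ Gs i) (ι := Gs)
    (fun i => (univ : Finset (Gs i))) r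
    (fun i v Er => twistedLift (g₁ i) (g₂ i) v Er) (fun i v d => linkAt (g₁ i) (g₂ i) v d)
    (fun i v Er => twistedLift_subset_edgeSet _ _ v Er)
    (fun i v Er d _ => mem_twistedLift_iff _ _ v Er d)
    (fun i v => injOn_linkAt (g₁ i) (g₂ i) v (hrn i))
    (fun i Er => ¬ IsCorrectableErasure {z : Gs i ⊕ Gs i → ZMod 2 | (code (g₁ i) (g₂ i)).HX *ᵥ z = 0}
      ((code (g₁ i) (g₂ i)).rowSpZ : Set (Gs i ⊕ Gs i → ZMod 2)) Er)
    (fun i Er hEr => by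
      obtain ⟨v, hv⟩ := exists_twistedLift_mem_siteToBoundary (g₁ i) (g₂ i) (hrn i) hEr
      exact ⟨v, Finset.mem_univ _, hv⟩)
    (fun c hc => by simpa [Finset.card_univ, hr] using hgrowth c hc)
  intro y hy0 hy
  have h' := h y hy0 hy
  unfold ErasureDecoder.uncorrectableProb
  convert h' using 5

/-- ★ **THE LOSS THRESHOLD OF EVERY TWISTED / ROTATED TORIC CODE FAMILY IS EXACTLY `1/2`** (generating pairs `g₁ⁱ, g₂ⁱ`, size
sub-exponential in the systole): floor `twistedToric_lossThreshold_half` (Kesten), ceiling the abelian two-block no-cloning bound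
(`AbelianTwoBlock.erasure_threshold_le_half`, `k = 2`). [cite: StaceBarrettDoherty2009, p. 1 (abstract: maximum tolerable loss rate 50%)] -/
theorem twistedToric_loss_accuracyThreshold_eq_half {Gs : ℕ → Type*} [∀ i, AddCommGroup (Gs i)] [∀ i, DecidableEq (Gs i)]
    [∀ i, Fintype (Gs i)] (g₁ g₂ : ∀ i, Gs i) (hgen : ∀ i (x : Gs i), ∃ m : ℤ × ℤ, m.1 • g₁ i + m.2 • g₂ i = x)
    (hgrowth : ∀ c : ℝ, 0 < c → Tendsto (fun i => (Fintype.card (Gs i) : ℝ) *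
      Real.exp (-c * (((systole (g₁ i) (g₂ i) - 1) / 4 : ℕ) : ℝ))) atTop (𝓝 0)) :
    accuracyThreshold (fun i y => ErasureDecoder.uncorrectableProb
      {z : Gs i ⊕ Gs i → ZMod 2 | (code (g₁ i) (g₂ i)).HX *ᵥ z = 0}
      ((code (g₁ i) (g₂ i)).rowSpZ : Set (Gs i ⊕ Gs i → ZMod 2)) y) = 1 / 2 := by
  refine le_antisymm ?_ (le_accuracyThreshold (twistedToric_lossThreshold_half g₁ g₂ hgrowth) (by norm_num))
  have hk : ∀ i, 0 < (AbelianTwoBlock.css (binom (g₁ i)) (binom (g₂ i))).k := fun i => by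
    have := code_k_eq_two (hgen i)
    rw [code] at this
    omega
  exact AbelianTwoBlock.erasure_threshold_le_half (fun i => binom (g₁ i)) (fun i => binom (g₂ i)) hk
    (isThresholdLowerBound_accuracyThreshold _)

end TwistedToric

end Literature.InformationTheory.QuantumCodes
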